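import Summits.HubbardSuperconductivity.HubbardSuperconductivity.Theorems.AnisotropyChordTowerProperPositionHolds
import Literature.Probability.NegativeDependence.ProperPositionStochasticDomination

/-!
# Theory seat `hubbard-h0-rotor-theory-1`, cycle 16 (g16), Part N18 — ADJACENT-SECTOR COVERING (COV) PROVED
(Verbatim port of the theory seat `hubbard-h0-rotor-theory-1` file `cycle16/lean/PartN18.lean (v2)`, sha16 2f6f2b221588abbc, by the prover seat
`hubbard-h0-rotor-p1` g18: tree namespace, linter option and docstring tags only; no new mathematics.)

Memo ROTOR-THEORY-16 §207(a).  **THEOREM COV.**  For every finite connected graph, `Δ ∈ [−1, 1]`, and normalised sector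
ground states `ψ` (sector `M`, weight `W`) and `φ` (sector `M − 1`, weight `W + 1`) of `H(Δ) = xxzHamiltonian 1 G (−1) Δ`,
the AMPLITUDE LAW of `ψ` (the law `S ↦ |ψ(1¹_S)| / Σ_T |ψ(1¹_T)|` on `(Finset V, ⊆)`) is stochastically dominated by that of
`φ`.  Since the two laws sit on the consecutive levels `W`, `W + 1`, a monotone coupling adds exactly one site: `φ` is a
ONE-SITE STOCHASTIC INSERTION of `ψ` at the amplitude level (Pemantle–Peres «stochastic covering», arXiv:1108.0687
Prop. 2.3 = Borcea–Brändén–Liggett Thm. 4.19, here for the XXZ tower instead of the truncations of one strongly Rayleigh law).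

PROOF (all ingredients are tree theorems).  Steps 1–3 of T-INT (`AnisotropyChordTowerProperPositionHolds`): the rescaled
heat flows of the sector indicators `𝟙_W`, `𝟙_{W+1}` converge to non-zero sector ground vectors `a`, `b` (`sector_groundProjection`)
which are moreover ENTRYWISE REAL NON-NEGATIVE (`gibbs_structure`, closedness) and satisfy: the occupation polynomial of
`a + u·b` is stable for every `u ∈ ℍ` (`gibbs_indPair_occStable`, `occStable_pair_of_limit`).  In the language of
`Literature.Combinatorics.StablePolynomials` this says `g_a^{hole} + z_{new} g_b^{hole}` is real stable, i.e. the HOLE LAWS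
(`T ↦ a(1⁰_T)`) satisfy `g_b ≪ g_a` (`isProperPosition_iff_isRealStable_add_X_mul`, Borcea–Brändén Lemma 1.8) — positive
rescalings allowed.  Borcea–Brändén–Liggett Prop. 4.12 in the tree (`stochDom_of_isProperPosition`) gives `holeLaw b ≼ holeLaw a`;
complementation `S ↦ Sᶜ` is an order anti-isomorphism of `Finset V`, so `particleLaw a ≼ particleLaw b`; finally `a = κ ψ`,
`b = κ' φ` (sector Perron–Frobenius uniqueness, `xxz_sector_perron_pos`), and the amplitude laws are phase-blind.

Supersedes the typed-only statement of Part N17 §1 (same text, namespace `…AnisotropyChord` instead of `….Transfer`).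
-/

set_option linter.dupNamespace false

noncomputable section

open Matrix Complex Finset Filter Topology
open scoped ComplexOrder
open Literature.MathematicalPhysics.QuantumLattice Literature.Probability.LatticeModels
open Literature.Combinatorics.StablePolynomials (multiAffine eval_multiAffine map_multiAffine IsProperPosition
  isProperPosition_iff_isRealStable_add_X_mul eval_map_rename_add_X_mul)
open Literature.Probability.NegativeDependence (mass mass_def stochDom_of_isProperPosition)
open Literature.Probability.MarkovChains (StochDom lawMean)

namespace Summit.HubbardSuperconductivity.HubbardSuperconductivity.Theorems.AnisotropyChord

variable {V : Type} [Fintype V] [DecidableEq V]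

/-! ## 0. The statement -/

/-- The spin-½ configuration with value `1` exactly on `S`. [folklore] -/
def oneOn (S : Finset V) : TensorIndex V 2 := fun x => if x ∈ S then 1 else 0

/-- The (modulus) AMPLITUDE LAW of a state as a law on `Finset V` (sites with value `1`), normalised to mass one
(junk if `ψ = 0`). [folklore] -/
def amplitudeLaw (ψ : TensorIndex V 2 → ℂ) : Finset V → ℝ :=
  fun S => ‖ψ (oneOn S)‖ / ∑ T : Finset V, ‖ψ (oneOn T)‖

/-- **COV — ADJACENT-SECTOR COVERING.** For every finite connected graph, `Δ ∈ [−1,1]`, and sector ground states `ψ`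
(sector `M`) and `φ` (sector `M − 1`): the amplitude law of `ψ` is stochastically dominated by that of `φ` (as laws on
`(Finset V, ⊆)`); equivalently (Strassen; consecutive levels) `φ`'s amplitude law is a one-site stochastic insertion of `ψ`'s.
[conjecture: theory seat hubbard-h0-rotor-theory-1, cycle 16, memo ROTOR-THEORY-16 §207 — proved below, `xxzAdjacentSectorCovering_holds`] -/
def XXZAdjacentSectorCovering : Prop :=
  ∀ (V : Type) [Fintype V] [DecidableEq V] (G : SimpleGraph V) [DecidableRel G.Adj],
    G.Connected → ∀ (M Δ : ℝ), -1 ≤ Δ → Δ ≤ 1 →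
      ∀ ψ φ : TensorIndex V 2 → ℂ, IsSectorGroundState G Δ M ψ → IsSectorGroundState G Δ (M - 1) φ →
        StochDom (amplitudeLaw ψ) (amplitudeLaw φ)

/-! ## 1. Real non-negative sector ground projections -/

/-- **Sector ground projection, with realness.** `sector_groundProjection` plus: the limit vector is entrywise real
non-negative (the rescaled flow of the non-negative indicator is, by `gibbs_structure`; the cone is closed). [folklore] -/
theorem sector_groundProjection_real (G : SimpleGraph V) [DecidableRel G.Adj] (hG : G.Connected) (Δ : ℝ)
    (W : ℕ) (hW : ∃ σ : V → Fin 2, (∑ z, (σ z : ℕ)) = W) :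
    ∃ a : TensorIndex V 2 → ℂ,
      a ∈ spinZSector (Λ := V) 1 (((Fintype.card V * 1 : ℕ) : ℝ) / 2 - W) ∧ a ≠ 0 ∧
      xxzHamiltonian 1 G (-1) Δ *ᵥ a =
        ((lowestEnergyInSector 1 (xxzHamiltonian 1 G (-1) Δ)
          (((Fintype.card V * 1 : ℕ) : ℝ) / 2 - W) : ℝ) : ℂ) • a ∧
      (∀ σ, 0 ≤ (a σ).re ∧ (a σ).im = 0) ∧
      Tendsto (fun t : ℝ => ((Real.exp (t * lowestEnergyInSector 1 (xxzHamiltonian 1 G (-1) Δ)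
          (((Fintype.card V * 1 : ℕ) : ℝ) / 2 - W)) : ℝ) : ℂ) •
        (NormedSpace.exp (-(t : ℂ) • xxzHamiltonian 1 G (-1) Δ) *ᵥ
          (fun σ : V → Fin 2 => if (Finset.univ.filter fun x => σ x = 1).card = W then (1 : ℂ) else 0)))
        atTop (𝓝 a) := by
  classical
  obtain ⟨a, haK, ha0, hHa, hlim⟩ := sector_groundProjection G hG Δ W hW
  refine ⟨a, haK, ha0, hHa, fun σ => ?_, hlim⟩
  set E := lowestEnergyInSector 1 (xxzHamiltonian 1 G (-1) Δ) (((Fintype.card V * 1 : ℕ) : ℝ) / 2 - W) with hE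
  set ind : (V → Fin 2) → ℂ :=
    fun σ => if (Finset.univ.filter fun x => σ x = 1).card = W then (1 : ℂ) else 0 with hind
  have hind_nn : ∀ τ, 0 ≤ (ind τ).re ∧ (ind τ).im = 0 := by
    intro τ; simp only [hind]; split_ifs <;> simp
  set F : ℝ → (TensorIndex V 2 → ℂ) := fun t =>
    ((Real.exp (t * E) : ℝ) : ℂ) • (NormedSpace.exp (-(t : ℂ) • xxzHamiltonian 1 G (-1) Δ) *ᵥ ind) with hF
  have hflow : ∀ t : ℝ, 0 ≤ t → 0 ≤ (F t σ).re ∧ (F t σ).im = 0 := by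
    intro t ht
    have h := (gibbs_structure G Δ ht).1 ind hind_nn σ
    simp only [hF, Pi.smul_apply, smul_eq_mul, Complex.re_ofReal_mul, Complex.im_ofReal_mul, h.2, mul_zero]
    exact ⟨mul_nonneg (Real.exp_pos _).le h.1, trivial⟩
  have hσlim : Tendsto (fun t : ℝ => F t σ) atTop (𝓝 (a σ)) := ((continuous_apply σ).tendsto a).comp hlim
  have hre : Tendsto (fun t : ℝ => (F t σ).re) atTop (𝓝 (a σ).re) := (Complex.continuous_re.tendsto _).comp hσlim
  have him : Tendsto (fun t : ℝ => (F t σ).im) atTop (𝓝 (a σ).im) := (Complex.continuous_im.tendsto _).comp hσlim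
  refine ⟨ge_of_tendsto hre ?_, ?_⟩
  · filter_upwards [eventually_ge_atTop (0 : ℝ)] with t ht using (hflow t ht).1
  · have h0 : Tendsto (fun t : ℝ => (F t σ).im) atTop (𝓝 0) := by
      refine tendsto_const_nhds.congr' ?_
      filter_upwards [eventually_ge_atTop (0 : ℝ)] with t ht using ((hflow t ht).2).symm
    exact tendsto_nhds_unique him h0

/-! ## 2. Hole weights and their generating polynomials -/

/-- The HOLE WEIGHT of a (real) vector: `T ↦ Re a(1⁰_T)`, `1⁰_T` the configuration with value `0` exactly on `T`. [folklore] -/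
def holeWeight (a : TensorIndex V 2 → ℂ) : Finset V → ℝ := fun T => (a (fun i => if i ∈ T then 0 else 1)).re

/-- For a real vector, the occupation sum is the (complexified) generating polynomial of the hole weight. [folklore] -/
theorem occSum_eq_eval_multiAffine_holeWeight (a : TensorIndex V 2 → ℂ) (ha : ∀ σ, (a σ).im = 0) (z : V → ℂ) :
    (∑ S : Finset V, a (fun i => if i ∈ S then 0 else 1) * ∏ i ∈ S, z i) =
      MvPolynomial.eval z (MvPolynomial.map (algebraMap ℝ ℂ) (multiAffine (holeWeight a))) := by
  rw [map_multiAffine, eval_multiAffine]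
  refine Finset.sum_congr rfl fun S _ => ?_
  congr 1
  simp only [Function.comp_apply, holeWeight, Complex.coe_algebraMap]
  exact Complex.ext (by simp) (by simp [ha])

omit [Fintype V] in
/-- Scaling: `holeWeight (c • a) = c • holeWeight a` for real `c`. [folklore] -/
theorem holeWeight_real_smul (c : ℝ) (a : TensorIndex V 2 → ℂ) :
    holeWeight ((c : ℂ) • a) = c • holeWeight a := by
  funext T
  simp [holeWeight]

/-- **Occupation-stable pair ⟹ hole generating polynomials in proper position** (after any positive rescaling):
if `a, b` are real and `occ_{a + u b}` is stable for all `u ∈ ℍ`, then `g_{c_b·hole b} ≪ g_{c_a·hole a}` for `c_a, c_b > 0`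
(Borcea–Brändén Lemma 1.8: `g + z_{new} f` real stable ⟺ `f ≪ g`). [folklore] -/
theorem isProperPosition_holeWeight {a b : TensorIndex V 2 → ℂ}
    (ha : ∀ σ, (a σ).im = 0) (hb : ∀ σ, (b σ).im = 0)
    (hpair : ∀ u : ℂ, 0 < u.im → ∀ z : V → ℂ, (∀ i, 0 < (z i).im) →
      (∑ S : Finset V, (a + u • b) (fun i => if i ∈ S then 0 else 1) * ∏ i ∈ S, z i) ≠ 0)
    {ca cb : ℝ} (hca : 0 < ca) (hcb : 0 < cb) :
    IsProperPosition (multiAffine (cb • holeWeight b)) (multiAffine (ca • holeWeight a)) := by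
  rw [isProperPosition_iff_isRealStable_add_X_mul]
  intro z hz
  rw [eval_map_rename_add_X_mul]
  set w : V → ℂ := fun i => z (some i) with hw
  have hwim : ∀ i, 0 < (w i).im := fun i => hz (some i)
  have hsa : ∀ σ, (((ca : ℂ) • a) σ).im = 0 := by intro σ; simp [ha σ]
  have hsb : ∀ σ, (((cb : ℂ) • b) σ).im = 0 := by intro σ; simp [hb σ]
  rw [← holeWeight_real_smul ca a, ← holeWeight_real_smul cb b,
    ← occSum_eq_eval_multiAffine_holeWeight _ hsa, ← occSum_eq_eval_multiAffine_holeWeight _ hsb,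
    occ_smul, occ_smul]
  -- `u := (c_b / c_a) · z_new ∈ ℍ`
  set u : ℂ := ((cb / ca : ℝ) : ℂ) * z none with hu
  have huim : 0 < u.im := by
    rw [hu, Complex.im_ofReal_mul]; exact mul_pos (div_pos hcb hca) (hz none)
  have key : (∑ S : Finset V, (a + u • b) (fun i => if i ∈ S then 0 else 1) * ∏ i ∈ S, w i) =
      (∑ S : Finset V, a (fun i => if i ∈ S then 0 else 1) * ∏ i ∈ S, w i) +
        u * (∑ S : Finset V, b (fun i => if i ∈ S then 0 else 1) * ∏ i ∈ S, w i) := by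
    have h := occ_add_smul 1 u a b w
    rw [one_smul, one_mul] at h
    exact h
  intro H0
  apply hpair u huim w hwim
  rw [key]
  have hca' : (ca : ℂ) ≠ 0 := Complex.ofReal_ne_zero.mpr hca.ne'
  have h2 : (ca : ℂ) * ((∑ S : Finset V, a (fun i => if i ∈ S then 0 else 1) * ∏ i ∈ S, w i) +
      u * (∑ S : Finset V, b (fun i => if i ∈ S then 0 else 1) * ∏ i ∈ S, w i)) = 0 := by
    rw [← H0, hu, Complex.ofReal_div]
    field_simp
  exact (mul_eq_zero.mp h2).resolve_left hca'

/-- The mass of the hole weight of a non-zero real non-negative vector is positive. [folklore] -/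
theorem mass_holeWeight_pos {a : TensorIndex V 2 → ℂ} (ha : ∀ σ, 0 ≤ (a σ).re ∧ (a σ).im = 0) (ha0 : a ≠ 0) :
    0 < mass (holeWeight a) := by
  rw [mass_def]
  obtain ⟨σ₀, hσ₀⟩ : ∃ σ₀, a σ₀ ≠ 0 := Function.ne_iff.mp ha0
  have hcfg : (fun i => if i ∈ (Finset.univ.filter fun x => σ₀ x = 0) then (0 : Fin 2) else 1) = σ₀ := by
    funext i
    by_cases h : σ₀ i = 0
    · simp [h]
    · simp [h, (Fin.eq_one_of_ne_zero _ h).symm]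
  refine Finset.sum_pos' (fun T _ => (ha _).1) ⟨Finset.univ.filter fun x => σ₀ x = 0, Finset.mem_univ _, ?_⟩
  simp only [holeWeight, hcfg]
  rcases (ha σ₀).1.eq_or_lt with h | h
  · exact absurd (Complex.ext (by simpa using h.symm) (by simpa using (ha σ₀).2)) hσ₀
  · exact h

/-- **BBL Prop. 4.12 applied:** the normalised hole law of `b` is stochastically dominated by that of `a`. [folklore] -/
theorem stochDom_holeLaw {a b : TensorIndex V 2 → ℂ}
    (ha : ∀ σ, 0 ≤ (a σ).re ∧ (a σ).im = 0) (hb : ∀ σ, 0 ≤ (b σ).re ∧ (b σ).im = 0) (ha0 : a ≠ 0) (hb0 : b ≠ 0)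
    (hpair : ∀ u : ℂ, 0 < u.im → ∀ z : V → ℂ, (∀ i, 0 < (z i).im) →
      (∑ S : Finset V, (a + u • b) (fun i => if i ∈ S then 0 else 1) * ∏ i ∈ S, z i) ≠ 0) :
    StochDom ((mass (holeWeight b))⁻¹ • holeWeight b) ((mass (holeWeight a))⁻¹ • holeWeight a) := by
  have hma := mass_holeWeight_pos ha ha0
  have hmb := mass_holeWeight_pos hb hb0
  refine stochDom_of_isProperPosition
    (isProperPosition_holeWeight (fun σ => (ha σ).2) (fun σ => (hb σ).2) hpair (inv_pos.mpr hma) (inv_pos.mpr hmb))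
    (fun S => ?_) (fun S => ?_) ?_
  · simp only [Pi.smul_apply, smul_eq_mul]; exact mul_nonneg (inv_pos.mpr hmb).le (hb _).1
  · simp only [Pi.smul_apply, smul_eq_mul]; exact mul_nonneg (inv_pos.mpr hma).le (ha _).1
  · have e : ∀ (ρ : Finset V → ℝ) (c : ℝ), mass (c • ρ) = c * mass ρ := by
      intro ρ c; simp only [mass_def, Pi.smul_apply, smul_eq_mul, Finset.mul_sum]
    rw [e, e, inv_mul_cancel₀ hmb.ne', inv_mul_cancel₀ hma.ne']

/-! ## 3. Complementation and the amplitude laws -/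

/-- Complementation `S ↦ Sᶜ` as an equivalence of `Finset V`. [folklore] -/
def complEquiv : Finset V ≃ Finset V where
  toFun S := Sᶜ
  invFun S := Sᶜ
  left_inv S := compl_compl S
  right_inv S := compl_compl S

/-- **Complementation reverses stochastic domination**: `μ ≼ ν ⟹ ν ∘ ᶜ ≼ μ ∘ ᶜ` (`S ↦ Sᶜ` is an order
anti-isomorphism of `(Finset V, ⊆)`). [folklore] -/
theorem stochDom_compl {μ ν : Finset V → ℝ} (h : StochDom μ ν) :
    StochDom (fun S => ν Sᶜ) (fun S => μ Sᶜ) := by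
  intro G hG
  have hF : Monotone (fun T : Finset V => -G Tᶜ) := by
    intro T T' hTT'
    simp only [neg_le_neg_iff]
    exact hG (Finset.compl_subset_compl.mpr hTT')
  have key := h _ hF
  have e : ∀ ρ : Finset V → ℝ, lawMean ρ (fun T : Finset V => -G Tᶜ) = -lawMean (fun S => ρ Sᶜ) G := by
    intro ρ
    simp only [lawMean, ← Finset.sum_neg_distrib]
    refine Fintype.sum_equiv complEquiv _ _ fun T => ?_
    simp [complEquiv]
  rw [e, e, neg_le_neg_iff] at key
  exact key

/-- The hole configuration on `T` is the particle configuration on `Tᶜ`. [folklore] -/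
theorem holeConfig_eq_oneOn_compl (T : Finset V) :
    (fun i => if i ∈ T then (0 : Fin 2) else 1) = oneOn Tᶜ := by
  funext i
  by_cases h : i ∈ T <;> simp [oneOn, h]

omit [Fintype V] [DecidableEq V] in
/-- For `a = κ • ψ` entrywise real non-negative: `Re a(σ) = ‖κ‖·‖ψ(σ)‖`. [folklore] -/
theorem re_eq_norm_mul_norm {a ψ : TensorIndex V 2 → ℂ} {κ : ℂ} (haψ : a = κ • ψ)
    (ha : ∀ σ, 0 ≤ (a σ).re ∧ (a σ).im = 0) (σ : TensorIndex V 2) : (a σ).re = ‖κ‖ * ‖ψ σ‖ := by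
  have hz : a σ = ((a σ).re : ℂ) := Complex.ext (by simp) (by simp [(ha σ).2])
  have h1 : ‖a σ‖ = (a σ).re := by
    rw [hz, Complex.norm_real, Real.norm_of_nonneg (by simpa using (ha σ).1)]; simp
  rw [← h1, haψ, Pi.smul_apply, smul_eq_mul, norm_mul]

/-- The PHASE-BLIND HOLE LAW of a state: `T ↦ ‖ψ(1⁰_T)‖`. [folklore] -/
def holeNorm (ψ : TensorIndex V 2 → ℂ) : Finset V → ℝ := fun T => ‖ψ (fun i => if i ∈ T then 0 else 1)‖

omit [Fintype V] in
/-- For `a = κ • ψ` real non-negative, `holeWeight a = ‖κ‖ • holeNorm ψ`. [folklore] -/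
theorem holeWeight_eq_smul_holeNorm {a ψ : TensorIndex V 2 → ℂ} {κ : ℂ} (haψ : a = κ • ψ)
    (ha : ∀ σ, 0 ≤ (a σ).re ∧ (a σ).im = 0) : holeWeight a = ‖κ‖ • holeNorm ψ := by
  funext T
  simp only [holeWeight, holeNorm, Pi.smul_apply, smul_eq_mul]
  exact re_eq_norm_mul_norm haψ ha _

/-- For `a = κ • ψ` real non-negative with `κ ≠ 0`, the normalised hole law of `a`, read through complementation, is the
amplitude law of `ψ`. [folklore] -/
theorem amplitudeLaw_eq_holeLaw_compl {a ψ : TensorIndex V 2 → ℂ} {κ : ℂ} (hκ : κ ≠ 0) (haψ : a = κ • ψ)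
    (ha : ∀ σ, 0 ≤ (a σ).re ∧ (a σ).im = 0) :
    amplitudeLaw ψ = fun S => ((mass (holeWeight a))⁻¹ • holeWeight a) Sᶜ := by
  have hw : ∀ T, holeWeight a T = ‖κ‖ * ‖ψ (oneOn Tᶜ)‖ := by
    intro T; rw [holeWeight, re_eq_norm_mul_norm haψ ha, holeConfig_eq_oneOn_compl]
  have hm : mass (holeWeight a) = ‖κ‖ * ∑ T : Finset V, ‖ψ (oneOn T)‖ := by
    rw [mass_def, Finset.mul_sum]
    simp only [hw]
    exact Fintype.sum_equiv complEquiv _ _ fun T => by simp [complEquiv]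
  funext S
  simp only [amplitudeLaw, Pi.smul_apply, smul_eq_mul, hw, hm, compl_compl]
  rw [inv_mul_eq_div, mul_div_mul_left _ _ (norm_ne_zero_iff.mpr hκ)]

/-! ## 4. The adjacent-sector data and THEOREM COV -/

/-- **Adjacent-sector data.** For sector ground states `ψ` (sector `M`) and `φ` (sector `M − 1`) on a connected graph with
`|Δ| ≤ 1`: entrywise real non-negative multiples `a = κ ψ`, `b = κ' φ` whose occupation pencil `occ_{a + u b}` is stable for all
`u ∈ ℍ` (Steps 1–3 and 5 of T-INT, with realness). [folklore] -/
theorem adjacentSector_data (G : SimpleGraph V) [DecidableRel G.Adj] (hG : G.Connected) {M Δ : ℝ}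
    (h1 : -1 ≤ Δ) (h2 : Δ ≤ 1) {ψ φ : TensorIndex V 2 → ℂ}
    (hψ : IsSectorGroundState G Δ M ψ) (hφ : IsSectorGroundState G Δ (M - 1) φ) :
    ∃ a b : TensorIndex V 2 → ℂ, ∃ κ κ' : ℂ,
      (∀ σ, 0 ≤ (a σ).re ∧ (a σ).im = 0) ∧ (∀ σ, 0 ≤ (b σ).re ∧ (b σ).im = 0) ∧ a ≠ 0 ∧ b ≠ 0 ∧
      κ ≠ 0 ∧ κ' ≠ 0 ∧ a = κ • ψ ∧ b = κ' • φ ∧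
      ∀ u : ℂ, 0 < u.im → ∀ z : V → ℂ, (∀ i, 0 < (z i).im) →
        (∑ S : Finset V, (a + u • b) (fun i => if i ∈ S then 0 else 1) * ∏ i ∈ S, z i) ≠ 0 := by
  classical
  obtain ⟨hψK, hψ1, hHψ⟩ := hψ
  obtain ⟨hφK, hφ1, hHφ⟩ := hφ
  have hψ0 : ψ ≠ 0 := by
    intro h; rw [h, dotProduct_zero] at hψ1; exact zero_ne_one hψ1
  have hφ0 : φ ≠ 0 := by
    intro h; rw [h, dotProduct_zero] at hφ1; exact zero_ne_one hφ1
  have hΔ : |Δ| ≤ 1 := abs_le.mpr ⟨h1, h2⟩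
  obtain ⟨W, hWatt, hMW⟩ := exists_weight_of_mem_spinZSector hψK hψ0
  obtain ⟨W', hW'att, hMW'⟩ := exists_weight_of_mem_spinZSector hφK hφ0
  have hW' : W' = W + 1 := by
    have h : (W' : ℝ) = (W : ℝ) + 1 := by linarith
    exact_mod_cast h
  subst hW'
  have hWn : W + 1 ≤ Fintype.card V := by
    obtain ⟨σ, hσ⟩ := hW'att
    rw [← hσ, weight_eq_card_filter]
    exact (Finset.card_filter_le _ _).trans (Finset.card_univ (α := V)).le
  set n : ℕ := Fintype.card V with hn
  set H := xxzHamiltonian 1 G (-1) Δ with hHdef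
  have hM1 : M - 1 = ((Fintype.card V * 1 : ℕ) : ℝ) / 2 - ((W + 1 : ℕ) : ℝ) := hMW'
  rw [hMW] at hψK hHψ
  rw [hM1] at hφK hHφ
  -- real non-negative sector ground projections `a` (weight `W`) and `b` (weight `W+1`)
  obtain ⟨a, haK, ha0, hHa, hann, hAlim⟩ := sector_groundProjection_real G hG Δ W hWatt
  obtain ⟨b, hbK, hb0, hHb, hbnn, hBlim⟩ := sector_groundProjection_real G hG Δ (W + 1) hW'att
  set E₀ : ℝ := lowestEnergyInSector 1 H (((Fintype.card V * 1 : ℕ) : ℝ) / 2 - W) with hE₀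
  set E₁ : ℝ := lowestEnergyInSector 1 H (((Fintype.card V * 1 : ℕ) : ℝ) / 2 - ((W + 1 : ℕ) : ℝ))
    with hE₁
  -- `a + u·b` is occupation-stable for every `u ∈ ℍ` (Steps 2–3 of T-INT, verbatim)
  have hpair : ∀ u : ℂ, 0 < u.im → ∀ z : V → ℂ, (∀ i, 0 < (z i).im) →
      (∑ S : Finset V, (a + u • b) (fun i => if i ∈ S then 0 else 1) * ∏ i ∈ S, z i) ≠ 0 := by
    refine occStable_pair_of_limit hAlim hBlim ?_ (fun u _ => add_smul_ne_zero_of_sectors haK ha0 hbK u)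
    intro u hu t ht z hz
    set c₀ : ℂ := ((Real.exp (t * E₀) : ℝ) : ℂ) with hc₀
    set c₁ : ℂ := ((Real.exp (t * E₁) : ℝ) : ℂ) with hc₁
    have hc₀ne : c₀ ≠ 0 := Complex.ofReal_ne_zero.mpr (Real.exp_pos _).ne'
    set u' : ℂ := u * c₁ / c₀ with hu'
    have hu'im : 0 < u'.im := by
      rw [hu', hc₀, hc₁, mul_div_assoc, ← Complex.ofReal_div, Complex.mul_im, Complex.ofReal_re,
        Complex.ofReal_im, mul_zero, zero_add]
      exact mul_pos hu (div_pos (Real.exp_pos _) (Real.exp_pos _))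
    have heq : c₀ • (NormedSpace.exp (-(t : ℂ) • H) *ᵥ
          (fun σ : V → Fin 2 => if (Finset.univ.filter fun x => σ x = 1).card = W then (1 : ℂ) else 0)) +
        u • (c₁ • (NormedSpace.exp (-(t : ℂ) • H) *ᵥ
          (fun σ : V → Fin 2 =>
            if (Finset.univ.filter fun x => σ x = 1).card = W + 1 then (1 : ℂ) else 0))) =
        c₀ • ((NormedSpace.exp (-(t : ℂ) • H) *ᵥ
          (fun σ : V → Fin 2 => if (Finset.univ.filter fun x => σ x = 1).card = W then (1 : ℂ) else 0)) +
          u' • (NormedSpace.exp (-(t : ℂ) • H) *ᵥ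
          (fun σ : V → Fin 2 =>
            if (Finset.univ.filter fun x => σ x = 1).card = W + 1 then (1 : ℂ) else 0))) := by
      rw [smul_add, smul_smul, smul_smul]
      congr 2
      rw [hu']
      field_simp
    rw [heq, occ_smul]
    exact mul_ne_zero hc₀ne (gibbs_indPair_occStable G hΔ ht hWn hu'im z hz)
  -- `a = κ • ψ`, `b = κ' • φ` (sector Perron–Frobenius uniqueness)
  obtain ⟨ψ₀, hψ₀K, hψ₀0, -, -, -, hHψ₀, huniq₀⟩ := xxz_sector_perron_pos G hG Δ W hWatt
  obtain ⟨ψ₁, hψ₁K, hψ₁0, -, -, -, hHψ₁, huniq₁⟩ := xxz_sector_perron_pos G hG Δ (W + 1) hW'att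
  obtain ⟨ca, hca⟩ := huniq₀ a haK hHa
  obtain ⟨cψ, hcψ⟩ := huniq₀ ψ hψK hHψ
  obtain ⟨cb, hcb⟩ := huniq₁ b hbK hHb
  obtain ⟨cφ, hcφ⟩ := huniq₁ φ hφK hHφ
  have hcψ0 : cψ ≠ 0 := by intro h; rw [h, zero_smul] at hcψ; exact hψ0 hcψ
  have hcφ0 : cφ ≠ 0 := by intro h; rw [h, zero_smul] at hcφ; exact hφ0 hcφ
  have hca0 : ca ≠ 0 := by intro h; rw [h, zero_smul] at hca; exact ha0 hca
  have hcb0 : cb ≠ 0 := by intro h; rw [h, zero_smul] at hcb; exact hb0 hcb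
  set κ : ℂ := ca * cψ⁻¹ with hκ
  set κ' : ℂ := cb * cφ⁻¹ with hκ'
  have haψ : a = κ • ψ := by
    rw [hκ, hca, ← smul_smul, hcψ, smul_smul cψ⁻¹, inv_mul_cancel₀ hcψ0, one_smul]
  have hbφ : b = κ' • φ := by
    rw [hκ', hcb, ← smul_smul, hcφ, smul_smul cφ⁻¹, inv_mul_cancel₀ hcφ0, one_smul]
  have hκ0 : κ ≠ 0 := mul_ne_zero hca0 (inv_ne_zero hcψ0)
  have hκ'0 : κ' ≠ 0 := mul_ne_zero hcb0 (inv_ne_zero hcφ0)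
  exact ⟨a, b, κ, κ', hann, hbnn, ha0, hb0, hκ0, hκ'0, haψ, hbφ, hpair⟩

/-- **THEOREM COV (adjacent-sector covering).** [folklore] -/
theorem xxzAdjacentSectorCovering_holds : XXZAdjacentSectorCovering := by
  intro V _ _ G _ hG M Δ h1 h2 ψ φ hψ hφ
  obtain ⟨a, b, κ, κ', hann, hbnn, ha0, hb0, hκ0, hκ'0, haψ, hbφ, hpair⟩ := adjacentSector_data G hG h1 h2 hψ hφ
  rw [amplitudeLaw_eq_holeLaw_compl hκ0 haψ hann, amplitudeLaw_eq_holeLaw_compl hκ'0 hbφ hbnn]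
  exact stochDom_compl (stochDom_holeLaw hann hbnn ha0 hb0 hpair)

/-! ## 5. The Borcea–Brändén form: phase-blind hole laws in proper position -/

/-- **T-INT in `IsProperPosition` form.** For adjacent-sector ground states `ψ` (sector `M`), `φ` (sector `M − 1`) on a connected
graph with `|Δ| ≤ 1`, the generating polynomials of the phase-blind hole laws are in proper position, `g_{hole φ} ≪ g_{hole ψ}` —
the tree's `IsProperPosition`, so the Borcea–Brändén toolbox (`IsProperPosition.pencil`, `.wronskian_nonneg`, …) applies
verbatim. [folklore] -/
theorem xxz_adjacent_holeNorm_isProperPosition (G : SimpleGraph V) [DecidableRel G.Adj] (hG : G.Connected) {M Δ : ℝ}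
    (h1 : -1 ≤ Δ) (h2 : Δ ≤ 1) {ψ φ : TensorIndex V 2 → ℂ}
    (hψ : IsSectorGroundState G Δ M ψ) (hφ : IsSectorGroundState G Δ (M - 1) φ) :
    IsProperPosition (multiAffine (holeNorm φ)) (multiAffine (holeNorm ψ)) := by
  obtain ⟨a, b, κ, κ', hann, hbnn, -, -, hκ0, hκ'0, haψ, hbφ, hpair⟩ := adjacentSector_data G hG h1 h2 hψ hφ
  have hκn : 0 < ‖κ‖ := norm_pos_iff.mpr hκ0
  have hκ'n : 0 < ‖κ'‖ := norm_pos_iff.mpr hκ'0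
  have h := isProperPosition_holeWeight (fun σ => (hann σ).2) (fun σ => (hbnn σ).2) hpair
    (inv_pos.mpr hκn) (inv_pos.mpr hκ'n)
  rwa [holeWeight_eq_smul_holeNorm haψ hann, holeWeight_eq_smul_holeNorm hbφ hbnn, smul_smul, smul_smul,
    inv_mul_cancel₀ hκn.ne', inv_mul_cancel₀ hκ'n.ne', one_smul, one_smul] at h

end Summit.HubbardSuperconductivity.HubbardSuperconductivity.Theorems.AnisotropyChord
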